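import Summits.BirchSwinnertonDyer.BirchSwinnertonDyer.Theorems.TwoAdicConverseBDPSelmerLowerDivisibilityAtTwoPrimePinning
import HarnessLib

/-!
# Negative lemmas for O2 `BDPSelmerLowerDivisibilityAtTwo` (stmt-BirchSwinnertonDyer-24728): load-bearing analysis of the
# squeeze seam (S = `GaussRigidity₂`, PIN = `PrimePinning₂`) of the line of record `kato_determinant_greenberg_two_O2_gv_squeeze_v4`

Helper file `--supports stmt-BirchSwinnertonDyer-24728` on the Negative lane (standing disprover `cdisprove-stmt-BirchSwinnertonDyer-24728`
g0; the same theorems, with named `Prop`s and the census, are published as `Cruxes/BDPSelmerLowerDivisibilityAtTwo/Disproof.lean`).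
THEOREMS ONLY (no definition, no named fact, no instance); nothing about any elliptic curve is asserted; O2 stays OPEN; BSD is
proved for no curve.  `A₂ = 𝒪_{ℂ₂}⟦T₁,T₂⟧`, `red₂` = coefficientwise reduction to `𝔽̄₂⟦T₁,T₂⟧`, `T` = the outer variable.

* `gaussRigidity₂_false_without_residue` — S with `red₂ C ≠ 0` dropped is FALSE (`C = 2, G = 4, h = 2, m = 0`): the RESIDUE
  half of TORSION ∧ RESIDUE (algebraic `μ = 0` of the generator, delivered by CONTENT) is load-bearing.
* `not_gaussRigidity₂WithSlack` — REFUTED STRENGTHENING: S with the slack `2^m` replaced by a non-zero `s ∈ A₂` (even with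
  `red₂ s ≠ 0`, even in the one-variable subring) is FALSE (`C = s = T + 2`, `G = h = T + 4`).  So U must be typed with
  CONSTANT slack, as it is: a U landed in the printed rational currency («`ch·h(T₁) ⊆ (𝓛)`», `h ≠ 0` non-constant) does not
  close O2 through this node.
* `not_gaussRigidity₂LowerResidual` — REFUTED STRENGTHENING: weakening `(red₂ G) = (red₂ C)` to the LOWER residual
  divisibility `red₂ G ∈ (red₂ C)` (free from U + CONTENT) is FALSE (`C = h = T`, `G = T²`); the UPPER one is the load-bearing
  half (and alone suffices: PIN at `𝔓 = ⊥`, tree).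
* `primePinning₂_false_without_N`, `primePinning₂_false_without_Λ` — PIN with (N) resp. (Λ) dropped is FALSE (`C₁ = h = T`,
  `G = T²`, `𝔓 = (T)` resp. `⊥`): TEST-μ's `μ(G|_𝔓) = 0` and the one-line `λ`-inequality are each load-bearing.
* `le_and_exists_unit_of_pin_anyIdeal`, `span_le_span_of_pin_anyIdeal` — MUTATION: `𝔓.IsPrime` is decoration; PIN holds for
  EVERY ideal `𝔓` and gives `a ≤ m`, `G = C₁·unit`.  `residualSpanEq_of_pin`: hence `(red₂ G) = (red₂ C₁)` — at the seam
  ACPIN ∧ U and RresEq ∧ U coincide.  `content_le_slack_of_pin`: `a ≤ m` (ADD-6 §A6.3's «`a ≤ m_U`»).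

References: [folklore] (Gauss's lemma over a rank-one valuation ring; local rings); tree p766427 (`TwoAdicBDPGaussContent`),
p768124 (`TwoAdicBDPPrimePinning`), whose proof of PIN is reused step for step.
-/

-- D-0017: single-problem summit, the namespace repeats the problem name by design.
set_option linter.dupNamespace false
set_option autoImplicit false

noncomputable section

open scoped Classical

namespace Summit.BirchSwinnertonDyer.BirchSwinnertonDyer.Theorems.BDPSelmerLowerDivisibilityAtTwo.Negative.SqueezeSeam

open PowerSeries Literature.NumberTheory.EllipticCurves
open Summit.BirchSwinnertonDyer.BirchSwinnertonDyer.Theorems.TwoAdicBDPGaussContent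
open Summit.BirchSwinnertonDyer.BirchSwinnertonDyer.Theorems.TwoAdicBDPPrimePinning

/-! ## §1 Small facts in `A₂ = 𝒪_{ℂ₂}⟦T₁,T₂⟧` (written `PowerSeries (PowerSeries (PadicComplexInt 2))`; `red₂` = `map (map residue)`, written out) -/

/-- `red₂ 2 = 0` (the special fibre has characteristic `2`). [folklore] -/
theorem red₂_two : (PowerSeries.map (PowerSeries.map (IsLocalRing.residue (PadicComplexInt 2)))) (2 : (PowerSeries (PowerSeries (PadicComplexInt 2)))) = 0 := by
  have h := map_map_residue_natCast_prime (p := 2)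
  rw [Nat.cast_ofNat] at h
  exact h

/-- `red₂ T = T` for the outer variable. [folklore] -/
theorem red₂_X : (PowerSeries.map (PowerSeries.map (IsLocalRing.residue (PadicComplexInt 2)))) (X : (PowerSeries (PowerSeries (PadicComplexInt 2)))) = X :=
  PowerSeries.map_X _

/-- `4 ∤ 2` in `𝒪_{ℂ₂}`: `2` is a non-zero non-unit of a domain. [folklore] -/
theorem two_mul_two_not_dvd_two : ¬ ((2 : PadicComplexInt 2) * 2 ∣ 2) := by
  rintro ⟨q, hq⟩
  have h2 : (2 : PadicComplexInt 2) ≠ 0 := by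
    have h := natCast_prime_padicComplexInt_ne_zero (p := 2)
    rwa [Nat.cast_ofNat] at h
  have hnu : ¬ IsUnit (2 : PadicComplexInt 2) := by
    have h := SignedBaseChangeK1RationalAnchor.not_isUnit_natCast_padicComplexInt (p := 2)
    rwa [Nat.cast_ofNat] at h
  have h1 : (2 : PadicComplexInt 2) * (2 * q) = 2 * 1 := by rw [mul_one, ← mul_assoc]; exact hq.symm
  exact hnu (IsUnit.of_mul_eq_one q (mul_left_cancel₀ h2 h1))

/-- `T(0,0) = 0`. [folklore] -/
theorem aug₂_X : (PowerSeries.constantCoeff.comp (PowerSeries.constantCoeff (R := PowerSeries (PadicComplexInt 2)))) (X : (PowerSeries (PowerSeries (PadicComplexInt 2)))) = 0 := by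
  simp

/-- `(T + 4) ∤ (T + 2)` in `A₂` (augment: `4 ∤ 2`). [folklore] -/
theorem X_add_four_not_dvd_X_add_two : ¬ ((X : (PowerSeries (PowerSeries (PadicComplexInt 2)))) + 2 * 2 ∣ X + 2) := by
  intro h
  have h' := map_dvd (PowerSeries.constantCoeff.comp (PowerSeries.constantCoeff (R := PowerSeries (PadicComplexInt 2)))) h
  rw [map_add, map_add, map_mul, aug₂_X, zero_add, zero_add, map_ofNat] at h'
  exact two_mul_two_not_dvd_two h'

/-- `4 ∤ 2` in `A₂`. [folklore] -/
theorem four_not_dvd_two : ¬ ((2 : (PowerSeries (PowerSeries (PadicComplexInt 2)))) * 2 ∣ 2) := by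
  intro h
  have h' := map_dvd (PowerSeries.constantCoeff.comp (PowerSeries.constantCoeff (R := PowerSeries (PadicComplexInt 2)))) h
  rw [map_mul, map_ofNat] at h'
  exact two_mul_two_not_dvd_two h'

/-- `T² ∤ T` in `A₂` (`T` is a non-zero non-unit of a domain). [folklore] -/
theorem X_sq_not_dvd_X : ¬ ((X : (PowerSeries (PowerSeries (PadicComplexInt 2)))) ^ 2 ∣ X) := by
  rintro ⟨q, hq⟩
  have h1 : (X : (PowerSeries (PowerSeries (PadicComplexInt 2)))) * (X * q) = X * 1 := by rw [mul_one, ← mul_assoc, ← pow_two]; exact hq.symm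
  have h2 : (X : (PowerSeries (PowerSeries (PadicComplexInt 2)))) * q = 1 := mul_left_cancel₀ X_ne_zero h1
  have h3 := congrArg PowerSeries.constantCoeff h2
  rw [map_mul, constantCoeff_X, zero_mul, map_one] at h3
  exact zero_ne_one h3

/-! ## §2 The seam S = `GaussRigidity₂` — load-bearing analysis and refuted strengthenings -/

/-- **Any proof through S must use `red₂ C ≠ 0` (algebraic `μ = 0` of the generator in residue currency).**
Witness `C = 2`, `G = 4`, `h = 2`, `m = 0`: `G = C·h`, `red C = red G = 0`, but `4 ∤ 2`. [folklore] -/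
theorem gaussRigidity₂_false_without_residue :
    ¬ (∀ (C G h : (PowerSeries (PowerSeries (PadicComplexInt 2)))) (m : ℕ), (2 : (PowerSeries (PowerSeries (PadicComplexInt 2)))) ^ m * G = C * h →
        Ideal.span {(PowerSeries.map (PowerSeries.map (IsLocalRing.residue (PadicComplexInt 2)))) G} = Ideal.span {(PowerSeries.map (PowerSeries.map (IsLocalRing.residue (PadicComplexInt 2)))) C} → Ideal.span {C} ≤ Ideal.span {G}) := by
  intro hS
  have h := hS 2 (2 * 2) 2 0 (by ring) (by rw [map_mul, red₂_two, mul_zero])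
  exact four_not_dvd_two (Ideal.span_singleton_le_span_singleton.mp h)

/-- **REFUTED STRENGTHENING: the squeeze does not survive a non-constant slack.**  Witness `C = s = T + 2`,
`G = h = T + 4`: `s·G = C·h`, `red C = red G = red s = T ≠ 0`, but `(T + 4) ∤ (T + 2)`.  (The line card's CAUTION, now a
theorem; the witness lives in the one-variable subring, so even a slack «`h(T₁) ≠ 0`» à la BSTW 9.24 is fatal.) [folklore] -/
theorem not_gaussRigidity₂WithSlack :
    ¬ (∀ (C G h s : (PowerSeries (PowerSeries (PadicComplexInt 2)))), s ≠ 0 → (PowerSeries.map (PowerSeries.map (IsLocalRing.residue (PadicComplexInt 2)))) s ≠ 0 → s * G = C * h → (PowerSeries.map (PowerSeries.map (IsLocalRing.residue (PadicComplexInt 2)))) C ≠ 0 →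
        Ideal.span {(PowerSeries.map (PowerSeries.map (IsLocalRing.residue (PadicComplexInt 2)))) G} = Ideal.span {(PowerSeries.map (PowerSeries.map (IsLocalRing.residue (PadicComplexInt 2)))) C} → Ideal.span {C} ≤ Ideal.span {G}) := by
  intro hS
  have hC : (PowerSeries.map (PowerSeries.map (IsLocalRing.residue (PadicComplexInt 2)))) ((X : (PowerSeries (PowerSeries (PadicComplexInt 2)))) + 2) = X := by rw [map_add, red₂_X, red₂_two, add_zero]
  have hG : (PowerSeries.map (PowerSeries.map (IsLocalRing.residue (PadicComplexInt 2)))) ((X : (PowerSeries (PowerSeries (PadicComplexInt 2)))) + 2 * 2) = X := by rw [map_add, map_mul, red₂_X, red₂_two, mul_zero, add_zero]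
  have hne : (X : (PowerSeries (PowerSeries (PadicComplexInt 2)))) + 2 ≠ 0 := fun h0 => by
    have h1 := congrArg (PowerSeries.map (PowerSeries.map (IsLocalRing.residue (PadicComplexInt 2)))) h0
    rw [hC, map_zero] at h1
    exact X_ne_zero h1
  have h := hS (X + 2) (X + 2 * 2) (X + 2 * 2) (X + 2) hne (by rw [hC]; exact X_ne_zero) (by ring)
    (by rw [hC]; exact X_ne_zero) (by rw [hC, hG])
  exact X_add_four_not_dvd_X_add_two (Ideal.span_singleton_le_span_singleton.mp h)

/-- **REFUTED STRENGTHENING: the lower residual divisibility is not enough** — the UPPER one `red₂ C ∈ ((PowerSeries.map (PowerSeries.map (IsLocalRing.residue (PadicComplexInt 2)))) G)` is the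
load-bearing half (and alone suffices: PIN at `𝔓 = ⊥`).  Witness `C = h = T`, `G = T²`, `m = 0`. [folklore] -/
theorem not_gaussRigidity₂LowerResidual :
    ¬ (∀ (C G h : (PowerSeries (PowerSeries (PadicComplexInt 2)))) (m : ℕ), (2 : (PowerSeries (PowerSeries (PadicComplexInt 2)))) ^ m * G = C * h → (PowerSeries.map (PowerSeries.map (IsLocalRing.residue (PadicComplexInt 2)))) C ≠ 0 →
        (PowerSeries.map (PowerSeries.map (IsLocalRing.residue (PadicComplexInt 2)))) G ∈ Ideal.span {(PowerSeries.map (PowerSeries.map (IsLocalRing.residue (PadicComplexInt 2)))) C} → Ideal.span {C} ≤ Ideal.span {G}) := by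
  intro hS
  have h := hS X (X ^ 2) X 0 (by ring) (by rw [red₂_X]; exact X_ne_zero)
    (by rw [map_pow, red₂_X, pow_two]; exact Ideal.mul_mem_left _ _ (Ideal.mem_span_singleton_self _))
  exact X_sq_not_dvd_X (Ideal.span_singleton_le_span_singleton.mp h)

/-! ## §3 PIN = `PrimePinning₂` — load-bearing analysis ((N), (Λ) necessary; primality of `𝔓` unnecessary) -/

/-- **Any proof through PIN must use (N): `μ = 0` of `G` along the pinning line.**  Witness `C₁ = h = T`, `G = T²`,
`a = m = 0`, `𝔓 = (T)` (prime; `G` vanishes identically along it). [folklore] -/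
theorem primePinning₂_false_without_N :
    ¬ (∀ (C₁ G h : (PowerSeries (PowerSeries (PadicComplexInt 2)))) (a m : ℕ) (𝔓 : Ideal (PowerSeries (PowerSeries (IsLocalRing.ResidueField (PadicComplexInt 2))))), 𝔓.IsPrime →
        (2 : (PowerSeries (PowerSeries (PadicComplexInt 2)))) ^ m * G = (2 : (PowerSeries (PowerSeries (PadicComplexInt 2)))) ^ a * C₁ * h → (PowerSeries.map (PowerSeries.map (IsLocalRing.residue (PadicComplexInt 2)))) C₁ ≠ 0 →
        (PowerSeries.map (PowerSeries.map (IsLocalRing.residue (PadicComplexInt 2)))) C₁ ∈ 𝔓 ⊔ Ideal.span {(PowerSeries.map (PowerSeries.map (IsLocalRing.residue (PadicComplexInt 2)))) G} → Ideal.span {(2 : (PowerSeries (PowerSeries (PadicComplexInt 2)))) ^ a * C₁} ≤ Ideal.span {G}) := by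
  intro hP
  have h := hP X (X ^ 2) X 0 0 (Ideal.span {X}) PowerSeries.span_X_isPrime (by ring)
    (by rw [red₂_X]; exact X_ne_zero) (by rw [red₂_X]; exact Ideal.mem_sup_left (Ideal.mem_span_singleton_self _))
  rw [pow_zero, one_mul] at h
  exact X_sq_not_dvd_X (Ideal.span_singleton_le_span_singleton.mp h)

/-- **Any proof through PIN must use (Λ).**  Witness `C₁ = h = T`, `G = T²`, `a = m = 0`, `𝔓 = ⊥`. [folklore] -/
theorem primePinning₂_false_without_Λ :
    ¬ (∀ (C₁ G h : (PowerSeries (PowerSeries (PadicComplexInt 2)))) (a m : ℕ) (𝔓 : Ideal (PowerSeries (PowerSeries (IsLocalRing.ResidueField (PadicComplexInt 2))))), 𝔓.IsPrime →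
        (2 : (PowerSeries (PowerSeries (PadicComplexInt 2)))) ^ m * G = (2 : (PowerSeries (PowerSeries (PadicComplexInt 2)))) ^ a * C₁ * h → (PowerSeries.map (PowerSeries.map (IsLocalRing.residue (PadicComplexInt 2)))) C₁ ≠ 0 → (PowerSeries.map (PowerSeries.map (IsLocalRing.residue (PadicComplexInt 2)))) G ∉ 𝔓 →
        Ideal.span {(2 : (PowerSeries (PowerSeries (PadicComplexInt 2)))) ^ a * C₁} ≤ Ideal.span {G}) := by
  intro hP
  have hN : (PowerSeries.map (PowerSeries.map (IsLocalRing.residue (PadicComplexInt 2)))) ((X : (PowerSeries (PowerSeries (PadicComplexInt 2)))) ^ 2) ∉ (⊥ : Ideal (PowerSeries (PowerSeries (IsLocalRing.ResidueField (PadicComplexInt 2))))) := by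
    rw [map_pow, red₂_X, Ideal.mem_bot]
    exact pow_ne_zero 2 X_ne_zero
  have h := hP X (X ^ 2) X 0 0 ⊥ Ideal.isPrime_bot (by ring) (by rw [red₂_X]; exact X_ne_zero) hN
  rw [pow_zero, one_mul] at h
  exact X_sq_not_dvd_X (Ideal.span_singleton_le_span_singleton.mp h)

/-- **MUTATION (positive): primality of `𝔓` is decoration in PIN — structure form.**  For EVERY ideal `𝔓` of
`𝔽̄₂⟦T₁,T₂⟧`: `2^m·G = 2^a·C₁·h`, `red C₁ ≠ 0`, `red G ∉ 𝔓`, `red C₁ ∈ 𝔓 ⊔ (red G)` ⟹ `a ≤ m` and `G = C₁·u` for a UNIT `u`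
of `A₂`.  Proof = the tree's (`TwoAdicBDPPrimePinning.span_le_span_of_prime_pin`) with the prime-avoidance step replaced by the
local-ring dichotomy: if `1 − q·red h₀` is a unit then `red G = (red G·(1 − q·red h₀))·(unit)⁻¹ ∈ 𝔓`, contradiction; else
`q·red h₀` is a unit. [folklore] -/
theorem le_and_exists_unit_of_pin_anyIdeal (C₁ G h : (PowerSeries (PowerSeries (PadicComplexInt 2)))) (a m : ℕ) (𝔓 : Ideal (PowerSeries (PowerSeries (IsLocalRing.ResidueField (PadicComplexInt 2)))))
    (hGCh : (2 : (PowerSeries (PowerSeries (PadicComplexInt 2)))) ^ m * G = (2 : (PowerSeries (PowerSeries (PadicComplexInt 2)))) ^ a * C₁ * h) (hC₁ : (PowerSeries.map (PowerSeries.map (IsLocalRing.residue (PadicComplexInt 2)))) C₁ ≠ 0) (hN : (PowerSeries.map (PowerSeries.map (IsLocalRing.residue (PadicComplexInt 2)))) G ∉ 𝔓)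
    (hΛ : (PowerSeries.map (PowerSeries.map (IsLocalRing.residue (PadicComplexInt 2)))) C₁ ∈ 𝔓 ⊔ Ideal.span {(PowerSeries.map (PowerSeries.map (IsLocalRing.residue (PadicComplexInt 2)))) G}) :
    a ≤ m ∧ ∃ u : (PowerSeries (PowerSeries (PadicComplexInt 2)))ˣ, G = C₁ * ↑u := by
  set P : (PowerSeries (PowerSeries (PadicComplexInt 2))) := (2 : (PowerSeries (PowerSeries (PadicComplexInt 2)))) with hP
  have hP' : P = ((2 : ℕ) : (PowerSeries (PowerSeries (PadicComplexInt 2)))) := by rw [Nat.cast_ofNat]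
  have hredP : (PowerSeries.map (PowerSeries.map (IsLocalRing.residue (PadicComplexInt 2)))) P = 0 := red₂_two
  rcases Nat.lt_or_ge m a with hma | ham
  · -- `m < a`: `G = 2·(…)`, so `red G = 0 ∈ 𝔓`, contradicting (N)
    obtain ⟨n, rfl⟩ : ∃ n, a = m + (n + 1) := ⟨a - m - 1, by omega⟩
    have hPm : P ^ m ≠ 0 := by rw [hP']; exact natCast_prime_pow_ne_zero (p := 2) m
    have h1 : G = P ^ (n + 1) * C₁ * h := by
      refine mul_left_cancel₀ hPm ?_
      rw [hGCh, pow_add]; ring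
    have h0 : (PowerSeries.map (PowerSeries.map (IsLocalRing.residue (PadicComplexInt 2)))) G = 0 := by
      rw [h1, map_mul, map_mul, map_pow, hredP, zero_pow (Nat.succ_ne_zero n), zero_mul, zero_mul]
    exact absurd (show (PowerSeries.map (PowerSeries.map (IsLocalRing.residue (PadicComplexInt 2)))) G ∈ 𝔓 by rw [h0]; exact 𝔓.zero_mem) hN
  · -- `a ≤ m`: cancel `2^a`, Gauss content for the constant `2^(m-a)`
    refine ⟨ham, ?_⟩
    obtain ⟨n, rfl⟩ := Nat.exists_eq_add_of_le ham
    have hPa : P ^ a ≠ 0 := by rw [hP']; exact natCast_prime_pow_ne_zero (p := 2) a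
    have hPn : P ^ n ≠ 0 := by rw [hP']; exact natCast_prime_pow_ne_zero (p := 2) n
    have h1 : P ^ n * G = C₁ * h := by
      refine mul_left_cancel₀ hPa ?_
      rw [← mul_assoc, ← pow_add, hGCh, mul_assoc]
    have hC₁u : ∃ i : ℕ × ℕ, IsUnit (coeff i.2 (coeff i.1 C₁)) :=
      exists_isUnit_coeff_of_map_map_residue_ne_zero hC₁
    have hdvd : PowerSeries.C (PowerSeries.C (((2 : ℕ) : PadicComplexInt 2) ^ n)) ∣ C₁ * h :=
      ⟨G, by rw [← h1, hP', natCast_pow_eq_C_C]⟩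
    obtain ⟨h₀, rfl⟩ := C_C_dvd_of_C_C_dvd_mul_of_exists_isUnit_coeff hC₁u hdvd
    have hG : G = C₁ * h₀ := by
      refine mul_left_cancel₀ hPn ?_
      rw [h1, hP', natCast_pow_eq_C_C]; ring
    obtain ⟨t, ht, s, hs, hts⟩ := Submodule.mem_sup.mp hΛ
    obtain ⟨q, rfl⟩ := Ideal.mem_span_singleton'.mp hs
    have hGred : (PowerSeries.map (PowerSeries.map (IsLocalRing.residue (PadicComplexInt 2)))) G = (PowerSeries.map (PowerSeries.map (IsLocalRing.residue (PadicComplexInt 2)))) C₁ * (PowerSeries.map (PowerSeries.map (IsLocalRing.residue (PadicComplexInt 2)))) h₀ := by rw [hG, map_mul]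
    have hkey : (PowerSeries.map (PowerSeries.map (IsLocalRing.residue (PadicComplexInt 2)))) G * (1 - q * (PowerSeries.map (PowerSeries.map (IsLocalRing.residue (PadicComplexInt 2)))) h₀) = t * (PowerSeries.map (PowerSeries.map (IsLocalRing.residue (PadicComplexInt 2)))) h₀ := by
      have e : (PowerSeries.map (PowerSeries.map (IsLocalRing.residue (PadicComplexInt 2)))) G = (t + q * (PowerSeries.map (PowerSeries.map (IsLocalRing.residue (PadicComplexInt 2)))) G) * (PowerSeries.map (PowerSeries.map (IsLocalRing.residue (PadicComplexInt 2)))) h₀ := by rw [hts]; exact hGred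
      linear_combination e
    have hmem : (PowerSeries.map (PowerSeries.map (IsLocalRing.residue (PadicComplexInt 2)))) G * (1 - q * (PowerSeries.map (PowerSeries.map (IsLocalRing.residue (PadicComplexInt 2)))) h₀) ∈ 𝔓 := by
      rw [hkey]; exact 𝔓.mul_mem_right _ ht
    have hunit : IsUnit (q * (PowerSeries.map (PowerSeries.map (IsLocalRing.residue (PadicComplexInt 2)))) h₀) := by
      rcases IsLocalRing.isUnit_or_isUnit_one_sub_self (q * (PowerSeries.map (PowerSeries.map (IsLocalRing.residue (PadicComplexInt 2)))) h₀) with hu | hu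
      · exact hu
      · exfalso
        refine hN ?_
        have e : (PowerSeries.map (PowerSeries.map (IsLocalRing.residue (PadicComplexInt 2)))) G = (PowerSeries.map (PowerSeries.map (IsLocalRing.residue (PadicComplexInt 2)))) G * (1 - q * (PowerSeries.map (PowerSeries.map (IsLocalRing.residue (PadicComplexInt 2)))) h₀) * ↑hu.unit⁻¹ := by
          rw [mul_assoc, IsUnit.mul_val_inv, mul_one]
        rw [e]
        exact 𝔓.mul_mem_right _ hmem
    obtain ⟨u, hu⟩ := isUnit_of_isUnit_map_map_residue (p := 2) (isUnit_of_mul_isUnit_right hunit)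
    exact ⟨u, by rw [hu]; exact hG⟩

/-- **PIN for EVERY ideal `𝔓`** (no primality): `(2^a·C₁) ⊆ (G)`. [folklore] -/
theorem span_le_span_of_pin_anyIdeal (C₁ G h : (PowerSeries (PowerSeries (PadicComplexInt 2)))) (a m : ℕ) (𝔓 : Ideal (PowerSeries (PowerSeries (IsLocalRing.ResidueField (PadicComplexInt 2)))))
    (hGCh : (2 : (PowerSeries (PowerSeries (PadicComplexInt 2)))) ^ m * G = (2 : (PowerSeries (PowerSeries (PadicComplexInt 2)))) ^ a * C₁ * h) (hC₁ : (PowerSeries.map (PowerSeries.map (IsLocalRing.residue (PadicComplexInt 2)))) C₁ ≠ 0) (hN : (PowerSeries.map (PowerSeries.map (IsLocalRing.residue (PadicComplexInt 2)))) G ∉ 𝔓)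
    (hΛ : (PowerSeries.map (PowerSeries.map (IsLocalRing.residue (PadicComplexInt 2)))) C₁ ∈ 𝔓 ⊔ Ideal.span {(PowerSeries.map (PowerSeries.map (IsLocalRing.residue (PadicComplexInt 2)))) G}) :
    Ideal.span {(2 : (PowerSeries (PowerSeries (PadicComplexInt 2)))) ^ a * C₁} ≤ Ideal.span {G} := by
  obtain ⟨-, u, hu⟩ := le_and_exists_unit_of_pin_anyIdeal C₁ G h a m 𝔓 hGCh hC₁ hN hΛ
  exact Ideal.span_singleton_le_span_singleton.mpr
    ⟨↑u⁻¹ * (2 : (PowerSeries (PowerSeries (PadicComplexInt 2)))) ^ a, by rw [hu, mul_assoc, Units.mul_inv_cancel_left, mul_comm]⟩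

/-- **Under the pinning hypotheses (at ANY ideal) the two-variable residual span equality already holds**:
`((PowerSeries.map (PowerSeries.map (IsLocalRing.residue (PadicComplexInt 2)))) G) = ((PowerSeries.map (PowerSeries.map (IsLocalRing.residue (PadicComplexInt 2)))) C₁)` — ACPIN ∧ U and RresEq ∧ U draw the same conclusion at the seam. [folklore] -/
theorem residualSpanEq_of_pin (C₁ G h : (PowerSeries (PowerSeries (PadicComplexInt 2)))) (a m : ℕ) (𝔓 : Ideal (PowerSeries (PowerSeries (IsLocalRing.ResidueField (PadicComplexInt 2)))))
    (hGCh : (2 : (PowerSeries (PowerSeries (PadicComplexInt 2)))) ^ m * G = (2 : (PowerSeries (PowerSeries (PadicComplexInt 2)))) ^ a * C₁ * h) (hC₁ : (PowerSeries.map (PowerSeries.map (IsLocalRing.residue (PadicComplexInt 2)))) C₁ ≠ 0) (hN : (PowerSeries.map (PowerSeries.map (IsLocalRing.residue (PadicComplexInt 2)))) G ∉ 𝔓)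
    (hΛ : (PowerSeries.map (PowerSeries.map (IsLocalRing.residue (PadicComplexInt 2)))) C₁ ∈ 𝔓 ⊔ Ideal.span {(PowerSeries.map (PowerSeries.map (IsLocalRing.residue (PadicComplexInt 2)))) G}) :
    Ideal.span {(PowerSeries.map (PowerSeries.map (IsLocalRing.residue (PadicComplexInt 2)))) G} = Ideal.span {(PowerSeries.map (PowerSeries.map (IsLocalRing.residue (PadicComplexInt 2)))) C₁} := by
  obtain ⟨-, u, hu⟩ := le_and_exists_unit_of_pin_anyIdeal C₁ G h a m 𝔓 hGCh hC₁ hN hΛ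
  have hu' : (PowerSeries.map (PowerSeries.map (IsLocalRing.residue (PadicComplexInt 2)))) G = (PowerSeries.map (PowerSeries.map (IsLocalRing.residue (PadicComplexInt 2)))) C₁ * (PowerSeries.map (PowerSeries.map (IsLocalRing.residue (PadicComplexInt 2)))) (↑u : (PowerSeries (PowerSeries (PadicComplexInt 2)))) := by rw [hu, map_mul]
  refine le_antisymm (Ideal.span_singleton_le_span_singleton.mpr ⟨(PowerSeries.map (PowerSeries.map (IsLocalRing.residue (PadicComplexInt 2)))) (↑u : (PowerSeries (PowerSeries (PadicComplexInt 2)))), hu'⟩)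
    (Ideal.span_singleton_le_span_singleton.mpr ⟨(PowerSeries.map (PowerSeries.map (IsLocalRing.residue (PadicComplexInt 2)))) (↑u⁻¹ : (PowerSeries (PowerSeries (PadicComplexInt 2)))), ?_⟩)
  rw [hu', mul_assoc, ← map_mul, Units.mul_inv, map_one, mul_one]

/-- **The slack exponent of U dominates the content of the generator**: under the pinning hypotheses `a ≤ m`
(bookkeeping «`a ≤ m_U`» of audit-2 ADD-6 §A6.3, now a kernel one-liner). [folklore] -/
theorem content_le_slack_of_pin (C₁ G h : (PowerSeries (PowerSeries (PadicComplexInt 2)))) (a m : ℕ) (𝔓 : Ideal (PowerSeries (PowerSeries (IsLocalRing.ResidueField (PadicComplexInt 2)))))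
    (hGCh : (2 : (PowerSeries (PowerSeries (PadicComplexInt 2)))) ^ m * G = (2 : (PowerSeries (PowerSeries (PadicComplexInt 2)))) ^ a * C₁ * h) (hC₁ : (PowerSeries.map (PowerSeries.map (IsLocalRing.residue (PadicComplexInt 2)))) C₁ ≠ 0) (hN : (PowerSeries.map (PowerSeries.map (IsLocalRing.residue (PadicComplexInt 2)))) G ∉ 𝔓)
    (hΛ : (PowerSeries.map (PowerSeries.map (IsLocalRing.residue (PadicComplexInt 2)))) C₁ ∈ 𝔓 ⊔ Ideal.span {(PowerSeries.map (PowerSeries.map (IsLocalRing.residue (PadicComplexInt 2)))) G}) : a ≤ m :=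
  (le_and_exists_unit_of_pin_anyIdeal C₁ G h a m 𝔓 hGCh hC₁ hN hΛ).1

end Summit.BirchSwinnertonDyer.BirchSwinnertonDyer.Theorems.BDPSelmerLowerDivisibilityAtTwo.Negative.SqueezeSeam

end
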